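import Literature.Analysis.FluidPDE.NewtonNearGradPotential
import Literature.Analysis.FluidPDE.NewtonFarGradPotential
import HarnessLib

/-!
# The gradient of the Newtonian potential of a compactly supported Hölder density:
`C^{1,γ}` regularity, symmetry of the second derivatives, and `Δ(Γ ⋆ f) = f`

Analysis/FluidPDE support file on the discharge path of the named fact
`Literature.Analysis.FluidPDE.MajdaBertozzi2002_holderEulerLocalExistence`
(`ElgindiBlowupContinuationProofs.lean`; Lagrangian decomposition `HolderEulerLagrangian.lean`).
It assembles the near part (`NewtonNearGradPotential.lean`: singular, Hölder theory) and the far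
part (`NewtonFarGradPotential.lean`: smooth) of the first-derivative potential

  `T_a f (x) = ∫ ∂_aΓ(x − y) • f(y) dy`  (`newtonGradPotential a f x`),

`Γ = −1/(4π|z|)` the Newtonian kernel of `ℝ³` (`newtonKernel`), for a compactly supported
`γ`-Hölder density `f : ℝ³ → F`, `0 < γ < 1` — the object behind Majda–Bertozzi's `K₃ f` and
`∇K₃ f` (*Vorticity and Incompressible Flow*, CUP 2002, §4.1.3 (4.29)–(4.39), p. 129 of the held
text: `K₃(z)h = h × ∇Γ(z)`, so the Biot–Savart velocity is a fixed combination of the `T_{eₖ}fⱼ`,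
`BiotSavartHolder.lean`) and behind Gilbarg–Trudinger's Lemmas 4.1–4.4 (2001):

* `newtonGradPotential_eq_near_add_far`: `T_a f = T⁰_a f + T∞_a f` (`∂_aΓ = ∂_aΓ₀ + ∂_aΓ∞` off
  the origin; the splitting radii are fixed to `(1, 2)`);
* `hasFDerivAt_newtonGradPotential`, `contDiff_one_newtonGradPotential`,
  `fderiv_newtonGradPotential_apply`:
  `∂_b T_a f(x) = ∫ ∂_b∂_aΓ₀(x−y)(f(y) − f(x)) dy + ∫ ∂_b∂_aΓ∞(x−y) f(y) dy`;
* `fderiv_newtonGradPotential_comm`: **`∂_b T_a f = ∂_a T_b f`** (symmetry of `D²Γ₀`, `D²Γ∞`);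
* `sum_fderiv_newtonGradPotential_apply_self`: **`Σᵢ ∂ᵢ T_{eᵢ} f (x) = f(x)`**, i.e.
  `Δ(Γ ⋆ f) = f` (Gilbarg–Trudinger Lemma 4.2: `ΔΓ₀ = −λ` off the origin, `ΔΓ∞ = λ`, `∫ λ = 1`
  — the tree's `laplacian_newtonNear`, `integral_newtonFarLaplacian`);
* `exists_newtonGradPotential_bounds` — **Majda–Bertozzi's (4.38)–(4.39) for `T_a`**: with
  `C = C(γ)`-free absolute constant `C`, for `f` `γ`-Hölder with constant `C_f`, `‖f‖ ≤ M_f`,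
  `supp f ⊆ B̄(c, R)`:
  `‖T_a f‖_∞ ≤ C‖a‖M_f(1 + R³)`, `‖D T_a f‖_∞ ≤ C‖a‖(C_f/γ + M_f R³)`,
  `[D T_a f]_γ ≤ C‖a‖(C_f(γ⁻¹ + (1−γ)⁻¹ + 1) + M_f R³)`.

## Mathlib / tree search

Tree (all used): `newtonNearGradPotential`, `newtonNearGradPotentialDeriv`,
`hasFDerivAt_newtonNearGradPotential`, `newtonNearGradPotentialDeriv_apply`,
`exists_newtonNearGradPotentialDeriv_bounds`, `norm_newtonNearGradPotential_le`,
`integrable_newtonNearGradPotential` (`NewtonNearGradPotential`); `newtonFarGradPotential`,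
`hasFDerivAt_newtonFarGradPotential`, `fderiv_newtonFarGradPotential_apply`,
`exists_newtonFarGradPotential_bounds`, `newtonFarHess_comm` (`NewtonFarGradPotential`);
`newtonNearHess_comm`, `fderiv_newtonNear_eq_sub`, `exists_abs_newtonNearGrad_le`
(`NewtonNearDerivatives`); `exists_isHolderCZKernel_newtonNearHess` (`NewtonNearCZ`);
`laplacian_newtonNear`, `newtonFarLaplacian`, `integral_newtonFarLaplacian`,
`hasCompactSupport_newtonFarLaplacian`, `continuous_newtonFarLaplacian` (`NewtonKernel`,
`NewtonPotential`). Mathlib: `laplacian_eq_iteratedFDeriv_orthonormalBasis`,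
`iteratedFDeriv_two_apply`, `EuclideanSpace.basisFun`, `Measure.ae`/`measure_singleton`.

## References

* A. J. Majda, A. L. Bertozzi, *Vorticity and Incompressible Flow* (CUP 2002), §4.1.3
  (4.29)–(4.39), Lemmas 4.5–4.6, p. 129. [MajdaBertozziCUP2002]
* D. Gilbarg, N. S. Trudinger, *Elliptic Partial Differential Equations of Second Order*
  (2001), Lemmas 4.1, 4.2, 4.4. [GilbargTrudinger2001]
-/

noncomputable section

open MeasureTheory Set Function Filter Metric Real
open _root_.Topology
open scoped NNReal ENNReal Laplacian

namespace Literature.Analysis.FluidPDE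

open NewtonPotentialHolder

/-- Local notation for physical space `ℝ³ = EuclideanSpace ℝ (Fin 3)`. -/
local notation "ℝ³" => EuclideanSpace ℝ (Fin 3)

/-- Local notation for the standard basis vectors of `ℝ³`. -/
local notation "𝐞" i => EuclideanSpace.single (i : Fin 3) (1 : ℝ)

variable {F : Type*} [NormedAddCommGroup F] [NormedSpace ℝ F]

/-! ### The gradient potential and its near/far splitting -/

/-- **The gradient of the Newtonian potential in the direction `a`**:
`T_a f (x) = ∫ ∂_aΓ(x − y) • f(y) dy = ∂_a(Γ ⋆ f)(x)`, `Γ(z) = −1/(4π|z|)`, `∂_aΓ(z) =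
⟨z, a⟩/(4π|z|³)` (Gilbarg–Trudinger (4.9)/Lemma 4.1; Majda–Bertozzi (4.29) with `K₃(z)h =
h × ∇Γ(z)`). Bochner integral; it converges for continuous compactly supported `f`
(`∂_aΓ ∈ L¹_loc`). [cite: GilbargTrudinger2001, Lemma 4.1 with (4.9)] -/
def newtonGradPotential (a : ℝ³) (f : ℝ³ → F) (x : ℝ³) : F :=
  ∫ y, fderiv ℝ newtonKernel (x - y) a • f y

/-- `∂_aΓ = ∂_aΓ₀ + ∂_aΓ∞` off the origin (splitting radii `(1, 2)`). [folklore] -/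
theorem fderiv_newtonKernel_apply_eq_near_add_far {z : ℝ³} (hz : z ≠ 0) (a : ℝ³) :
    fderiv ℝ newtonKernel z a = newtonNearGrad 1 2 a z + newtonFarGrad 1 2 a z := by
  rw [newtonNearGrad, newtonFarGrad, fderiv_newtonNear_eq_sub one_pos one_lt_two hz, sub_apply,
    sub_add_cancel]

/-- Inside the inner radius the near gradient kernel in a coordinate direction is the tree's
coordinate gradient of `Γ`: `newtonNearGrad r₀ r₁ eⱼ z = newtonKernelGrad j z` for `0 < |z| < r₀`
(pointer requested in the review of `NewtonNearDerivatives.lean`). [folklore] -/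
theorem newtonNearGrad_single_eq_newtonKernelGrad {r₀ r₁ : ℝ} (h₀ : 0 ≤ r₀) (h₁ : r₀ < r₁)
    (j : Fin 3) {z : ℝ³} (hz : z ≠ 0) (hzr : ‖z‖ < r₀) :
    newtonNearGrad r₀ r₁ (𝐞 j) z = newtonKernelGrad j z := by
  rw [newtonNearGrad, fderiv_newtonNear_eq_of_lt h₀ h₁ hzr, newtonKernelGrad_eq_fderiv hz]

/-- The far integrand is integrable for continuous compactly supported `f`. [folklore] -/
theorem integrable_newtonFarGrad_sub_smul (a : ℝ³) {f : ℝ³ → F} (hf : Continuous f)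
    (hfc : HasCompactSupport f) (x : ℝ³) :
    Integrable fun y => newtonFarGrad 1 2 a (x - y) • f y :=
  integrable_bilin_kernel_sub_of_hasCompactSupport
    (contDiff_newtonFarGrad one_pos one_lt_two a (n := 0)).continuous (ContinuousLinearMap.lsmul ℝ ℝ)
    hf hfc x

/-- **`T_a f = T⁰_a f + T∞_a f`** for continuous compactly supported `f` (the integrands agree
off the null set `{y = x}`). [folklore] -/
theorem newtonGradPotential_eq_near_add_far (a : ℝ³) {f : ℝ³ → F} (hf : Continuous f)
    (hfc : HasCompactSupport f) (x : ℝ³) :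
    newtonGradPotential a f x =
      newtonNearGradPotential 1 2 a f x + newtonFarGradPotential 1 2 a f x := by
  rw [newtonGradPotential, newtonNearGradPotential, newtonFarGradPotential,
    ← integral_add (integrable_newtonNearGradPotential one_pos one_lt_two a hf x)
      (integrable_newtonFarGrad_sub_smul a hf hfc x)]
  refine integral_congr_ae ?_
  have hx : ∀ᵐ y ∂(volume : Measure ℝ³), y ≠ x := by
    rw [ae_iff]
    simp only [ne_eq, not_not, setOf_eq_eq_singleton, measure_singleton]
  filter_upwards [hx] with y hy
  rw [fderiv_newtonKernel_apply_eq_near_add_far (sub_ne_zero.2 (Ne.symm hy)) a, add_smul]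

/-- The function form of the splitting. [folklore] -/
theorem newtonGradPotential_eq_near_add_far' (a : ℝ³) {f : ℝ³ → F} (hf : Continuous f)
    (hfc : HasCompactSupport f) :
    newtonGradPotential a f =
      fun x => newtonNearGradPotential 1 2 a f x + newtonFarGradPotential 1 2 a f x :=
  funext fun x => newtonGradPotential_eq_near_add_far a hf hfc x

/-! ### Differentiability and the derivative formula -/

section Deriv

variable [CompleteSpace F]

/-- **The gradient potential of a compactly supported Hölder density is differentiable**, with
derivative the sum of the near derivative (`b ↦ S_{ab}f(x)`) and the far one. [folklore] -/
theorem hasFDerivAt_newtonGradPotential (a : ℝ³) {f : ℝ³ → F} {Cf γ : ℝ≥0} (hf : HolderWith Cf γ f)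
    (hγ : 0 < γ) (hγ1 : γ < 1) (hfc : HasCompactSupport f) (x : ℝ³) :
    HasFDerivAt (newtonGradPotential a f)
      (newtonNearGradPotentialDeriv 1 2 a f x +
        ∫ y, (fderiv ℝ (newtonFarGrad 1 2 a) (x - y)).smulRight (f y)) x := by
  rw [newtonGradPotential_eq_near_add_far' a (hf.continuous hγ) hfc]
  exact (hasFDerivAt_newtonNearGradPotential one_pos one_lt_two a hf hγ hγ1 x).add
    (hasFDerivAt_newtonFarGradPotential one_pos one_lt_two a (hf.continuous hγ) hfc x)

/-- `fderiv (T_a f) = fderiv (T⁰_a f) + fderiv (T∞_a f)`. [folklore] -/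
theorem fderiv_newtonGradPotential (a : ℝ³) {f : ℝ³ → F} {Cf γ : ℝ≥0} (hf : HolderWith Cf γ f)
    (hγ : 0 < γ) (hγ1 : γ < 1) (hfc : HasCompactSupport f) (x : ℝ³) :
    fderiv ℝ (newtonGradPotential a f) x =
      fderiv ℝ (newtonNearGradPotential 1 2 a f) x + fderiv ℝ (newtonFarGradPotential 1 2 a f) x := by
  rw [(hasFDerivAt_newtonGradPotential a hf hγ hγ1 hfc x).fderiv,
    fderiv_newtonNearGradPotential one_pos one_lt_two a hf hγ hγ1 x,
    (hasFDerivAt_newtonFarGradPotential one_pos one_lt_two a (hf.continuous hγ) hfc x).fderiv]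

/-- **The derivative formula** (Gilbarg–Trudinger (4.10), boundary-free):
`∂_b T_a f(x) = ∫ ∂_b∂_aΓ₀(x − y)(f(y) − f(x)) dy + ∫ ∂_b∂_aΓ∞(x − y) f(y) dy`. [cite: GilbargTrudinger2001, Lemma 4.2 with (4.10)] -/
theorem fderiv_newtonGradPotential_apply (a : ℝ³) {f : ℝ³ → F} {Cf γ : ℝ≥0} (hf : HolderWith Cf γ f)
    (hγ : 0 < γ) (hγ1 : γ < 1) (hfc : HasCompactSupport f) (x b : ℝ³) :
    fderiv ℝ (newtonGradPotential a f) x b =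
      czDiff (newtonNearHess 1 2 a b) f x + ∫ y, newtonFarHess 1 2 a b (x - y) • f y := by
  rw [fderiv_newtonGradPotential a hf hγ hγ1 hfc x, add_apply,
    fderiv_newtonNearGradPotential_apply one_pos one_lt_two a hf hγ hγ1 x b,
    fderiv_newtonFarGradPotential_apply one_pos one_lt_two a (hf.continuous hγ) hfc x b]

/-- **The gradient potential of a compactly supported Hölder density is `C¹`.** [folklore] -/
theorem contDiff_one_newtonGradPotential (a : ℝ³) {f : ℝ³ → F} {Cf γ : ℝ≥0} (hf : HolderWith Cf γ f)
    (hγ : 0 < γ) (hγ1 : γ < 1) (hfc : HasCompactSupport f) :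
    ContDiff ℝ 1 (newtonGradPotential a f) := by
  rw [newtonGradPotential_eq_near_add_far' a (hf.continuous hγ) hfc]
  exact (contDiff_one_newtonNearGradPotential one_pos one_lt_two a hf hγ hγ1).add
    (contDiff_one_newtonFarGradPotential one_pos one_lt_two a (hf.continuous hγ) hfc)

/-! ### Symmetry of the second derivatives -/

/-- **`∂_b T_a f = ∂_a T_b f`**: the second derivatives of the Newtonian potential are
symmetric (both kernels `∂_b∂_aΓ₀`, `∂_b∂_aΓ∞` are). [folklore] -/
theorem fderiv_newtonGradPotential_comm (a b : ℝ³) {f : ℝ³ → F} {Cf γ : ℝ≥0}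
    (hf : HolderWith Cf γ f) (hγ : 0 < γ) (hγ1 : γ < 1) (hfc : HasCompactSupport f) (x : ℝ³) :
    fderiv ℝ (newtonGradPotential a f) x b = fderiv ℝ (newtonGradPotential b f) x a := by
  rw [fderiv_newtonGradPotential_apply a hf hγ hγ1 hfc x b,
    fderiv_newtonGradPotential_apply b hf hγ hγ1 hfc x a]
  have h1 : newtonNearHess 1 2 a b = newtonNearHess 1 2 b a :=
    funext fun z => newtonNearHess_comm one_pos one_lt_two a b z
  have h2 : ∀ z, newtonFarHess 1 2 a b z = newtonFarHess 1 2 b a z := fun z =>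
    newtonFarHess_comm one_pos one_lt_two a b z
  rw [h1]
  simp_rw [h2]

/-! ### The trace identity `Δ(Γ ⋆ f) = f` -/

/-- `Σᵢ ∂ᵢ∂ᵢΓ₀(z) = ΔΓ₀(z)` (the Laplacian is the trace of `D²` in the standard basis; no
differentiability needed for this identity between junk-compatible expressions). [folklore] -/
theorem sum_newtonNearHess_self (r₀ r₁ : ℝ) (z : ℝ³) :
    ∑ i : Fin 3, newtonNearHess r₀ r₁ (𝐞 i) (𝐞 i) z = (Δ (newtonNear r₀ r₁)) z := by
  rw [InnerProductSpace.laplacian_eq_iteratedFDeriv_orthonormalBasis (newtonNear r₀ r₁)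
    (EuclideanSpace.basisFun (Fin 3) ℝ)]
  simp only [EuclideanSpace.basisFun_apply, iteratedFDeriv_two_apply, Matrix.cons_val_zero,
    Matrix.cons_val_one, newtonNearHess]

/-- `Σᵢ ∂ᵢ∂ᵢΓ∞(z) = ΔΓ∞(z) = λ(z)`. [folklore] -/
theorem sum_newtonFarHess_self (r₀ r₁ : ℝ) (z : ℝ³) :
    ∑ i : Fin 3, newtonFarHess r₀ r₁ (𝐞 i) (𝐞 i) z = newtonFarLaplacian r₀ r₁ z := by
  rw [newtonFarLaplacian,
    InnerProductSpace.laplacian_eq_iteratedFDeriv_orthonormalBasis (newtonFar r₀ r₁)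
      (EuclideanSpace.basisFun (Fin 3) ℝ)]
  simp only [EuclideanSpace.basisFun_apply, iteratedFDeriv_two_apply, Matrix.cons_val_zero,
    Matrix.cons_val_one, newtonFarHess]

/-- **`Δ(Γ ⋆ f) = f`: `Σᵢ ∂ᵢ T_{eᵢ} f (x) = f(x)`** for a compactly supported `γ`-Hölder `f`,
`0 < γ < 1` (Gilbarg–Trudinger Lemma 4.2 in the sphere-free form: `ΔΓ₀ = −λ` off the origin,
`ΔΓ∞ = λ`, so the two pieces combine to `(∫ λ) f(x) = f(x)`). [cite: GilbargTrudinger2001, Lemma 4.2] -/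
theorem sum_fderiv_newtonGradPotential_apply_self {f : ℝ³ → F} {Cf γ : ℝ≥0} (hf : HolderWith Cf γ f)
    (hγ : 0 < γ) (hγ1 : γ < 1) (hfc : HasCompactSupport f) (x : ℝ³) :
    ∑ i : Fin 3, fderiv ℝ (newtonGradPotential (𝐞 i) f) x (𝐞 i) = f x := by
  have hfcont : Continuous f := hf.continuous hγ
  obtain ⟨A, B, A₀, -, -, -, hK⟩ := exists_isHolderCZKernel_newtonNearHess one_pos one_lt_two
  set lam : ℝ³ → ℝ := newtonFarLaplacian 1 2 with hlam
  have hlamc : Continuous lam := continuous_newtonFarLaplacian one_pos one_lt_two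
  have hlamcs : HasCompactSupport lam := hasCompactSupport_newtonFarLaplacian zero_le_one one_lt_two
  -- integrability of the pieces
  have In : ∀ i : Fin 3, Integrable fun y => newtonNearHess 1 2 (𝐞 i) (𝐞 i) (x - y) • (f y - f x) :=
    fun i => (hK _ _).integrable_czDiff hf hγ hγ1 x
  have If : ∀ i : Fin 3, Integrable fun y => newtonFarHess 1 2 (𝐞 i) (𝐞 i) (x - y) • f y := fun i =>
    integrable_bilin_kernel_sub_of_hasCompactSupport
      (contDiff_newtonFarHess one_pos one_lt_two _ _ (n := 0)).continuous
      (ContinuousLinearMap.lsmul ℝ ℝ) hfcont hfc x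
  -- the kernel `λ(x − y)` against anything continuous is integrable (continuous, compact support)
  have hlk : ∀ {g : ℝ³ → F}, Continuous g → Integrable fun y => lam (x - y) • g y := fun {g} hg =>
    integrable_kernel_sub_smul_of_continuous hlamc hlamcs (ContinuousLinearMap.lsmul ℝ ℝ) hg x
  -- rewrite each summand and sum the integrals
  have step1 : ∑ i : Fin 3, fderiv ℝ (newtonGradPotential (𝐞 i) f) x (𝐞 i) =
      (∫ y, (∑ i : Fin 3, newtonNearHess 1 2 (𝐞 i) (𝐞 i) (x - y)) • (f y - f x)) +
        ∫ y, (∑ i : Fin 3, newtonFarHess 1 2 (𝐞 i) (𝐞 i) (x - y)) • f y := by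
    simp_rw [fderiv_newtonGradPotential_apply _ hf hγ hγ1 hfc x, czDiff]
    rw [Finset.sum_add_distrib, ← integral_finsetSum _ fun i _ => In i,
      ← integral_finsetSum _ fun i _ => If i]
    congr 1
    · refine integral_congr_ae (Eventually.of_forall fun y => ?_)
      simp only [Finset.sum_smul]
    · refine integral_congr_ae (Eventually.of_forall fun y => ?_)
      simp only [Finset.sum_smul]
  rw [step1]
  -- the traces are `−λ` (off the diagonal) and `λ`
  have hx : ∀ᵐ y ∂(volume : Measure ℝ³), y ≠ x := by
    rw [ae_iff]
    simp only [ne_eq, not_not, setOf_eq_eq_singleton, measure_singleton]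
  have e1 : (∫ y, (∑ i : Fin 3, newtonNearHess 1 2 (𝐞 i) (𝐞 i) (x - y)) • (f y - f x)) =
      ∫ y, (-lam (x - y)) • (f y - f x) := by
    refine integral_congr_ae ?_
    filter_upwards [hx] with y hy
    rw [sum_newtonNearHess_self, laplacian_newtonNear one_pos one_lt_two (sub_ne_zero.2 (Ne.symm hy))]
  have e2 : (∫ y, (∑ i : Fin 3, newtonFarHess 1 2 (𝐞 i) (𝐞 i) (x - y)) • f y) =
      ∫ y, lam (x - y) • f y := by
    refine integral_congr_ae (Eventually.of_forall fun y => ?_)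
    show (∑ i : Fin 3, newtonFarHess 1 2 (𝐞 i) (𝐞 i) (x - y)) • f y = lam (x - y) • f y
    rw [sum_newtonFarHess_self]
  have I0 : Integrable fun y => lam (x - y) • (f y - f x) := hlk (hfcont.sub continuous_const)
  have I1 : Integrable fun y => (-lam (x - y)) • (f y - f x) :=
    I0.neg.congr (Eventually.of_forall fun y => by simp only [Pi.neg_apply, neg_smul])
  rw [e1, e2, ← integral_add I1 (hlk hfcont)]
  have e3 : ∀ y, (-lam (x - y)) • (f y - f x) + lam (x - y) • f y = lam (x - y) • f x := fun y => by
    rw [neg_smul, smul_sub]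
    abel
  simp_rw [e3]
  rw [integral_smul_const, integral_sub_left_eq_self lam volume x, hlam,
    integral_newtonFarLaplacian one_pos one_lt_two, one_smul]

/-! ### Bounds: Majda–Bertozzi (4.38)–(4.39) for the gradient potential -/

omit [NormedSpace ℝ F] [CompleteSpace F] in
/-- The `L¹` norm of a bounded function supported in `B̄(c, R)` is at most `5 M_f R³`
(`|B̄_R| = 4πR³/3 < 5R³`). [folklore] -/
theorem integral_norm_le_of_tsupport_subset {f : ℝ³ → F} {Mf R : ℝ} {c : ℝ³}
    (hMf : ∀ y, ‖f y‖ ≤ Mf) (hsupp : tsupport f ⊆ closedBall c R) (hR : 0 ≤ R) :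
    ∫ y, ‖f y‖ ≤ 5 * Mf * R ^ 3 := by
  have hMf0 : 0 ≤ Mf := (norm_nonneg _).trans (hMf c)
  have hpt : ∀ y, ‖f y‖ ≤ (closedBall c R).indicator (fun _ => Mf) y := fun y => by
    by_cases hy : y ∈ closedBall c R
    · rw [indicator_of_mem hy]; exact hMf y
    · rw [indicator_of_notMem hy, image_eq_zero_of_notMem_tsupport (fun h => hy (hsupp h)), norm_zero]
  have hint : Integrable ((closedBall c R).indicator fun _ : ℝ³ => Mf) :=
    (integrableOn_const (measure_closedBall_lt_top (x := c) (r := R)).ne).integrable_indicator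
      measurableSet_closedBall
  have h1 : ∫ y, ‖f y‖ ≤ ∫ y, (closedBall c R).indicator (fun _ => Mf) y := by
    by_cases hfi : Integrable (fun y => ‖f y‖)
    · exact integral_mono hfi hint hpt
    · rw [integral_undef hfi]
      exact integral_nonneg fun y => by
        by_cases hy : y ∈ closedBall c R
        · rw [indicator_of_mem hy]; exact hMf0
        · rw [indicator_of_notMem hy]; exact le_rfl
  refine h1.trans ?_
  rw [integral_indicator_const _ measurableSet_closedBall, smul_eq_mul, measureReal_def,
    EuclideanSpace.volume_closedBall_fin_three, ENNReal.toReal_mul, ← ENNReal.ofReal_pow hR,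
    ENNReal.toReal_ofReal (by positivity), ENNReal.toReal_ofReal (by positivity)]
  have hπ : π * 4 / 3 ≤ 5 := by
    have := Real.pi_lt_d2  -- π < 3.15
    nlinarith
  calc R ^ 3 * (π * 4 / 3) * Mf ≤ R ^ 3 * 5 * Mf := by gcongr
    _ = 5 * Mf * R ^ 3 := by ring

/-- From `min(N₃ t, 2N₂)` to a `γ`-Hölder modulus: for `t ≥ 0`, `0 < γ ≤ 1`,
`min (N₃ t) (2N₂) ≤ (N₃ + 2N₂) t^γ`. [folklore] -/
theorem min_linear_const_le_rpow {N₂ N₃ t γ' : ℝ} (hN₂ : 0 ≤ N₂) (hN₃ : 0 ≤ N₃) (ht : 0 ≤ t)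
    (hγ : 0 < γ') (hγ1 : γ' ≤ 1) {q : ℝ} (hq1 : q ≤ N₃ * t) (hq2 : q ≤ 2 * N₂) :
    q ≤ (N₃ + 2 * N₂) * t ^ γ' := by
  rcases le_or_gt t 1 with h1 | h1
  · have htγ : t ≤ t ^ γ' := Real.self_le_rpow_of_le_one ht h1 hγ1
    calc q ≤ N₃ * t := hq1
      _ ≤ N₃ * t ^ γ' := mul_le_mul_of_nonneg_left htγ hN₃
      _ ≤ (N₃ + 2 * N₂) * t ^ γ' := by
          refine mul_le_mul_of_nonneg_right (by linarith) (Real.rpow_nonneg ht _)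
  · have htγ : 1 ≤ t ^ γ' := Real.one_le_rpow h1.le hγ.le
    calc q ≤ 2 * N₂ := hq2
      _ ≤ 2 * N₂ * t ^ γ' := le_mul_of_one_le_right (by positivity) htγ
      _ ≤ (N₃ + 2 * N₂) * t ^ γ' := by
          refine mul_le_mul_of_nonneg_right (by linarith) (Real.rpow_nonneg ht _)

/-- **Majda–Bertozzi's (4.38)–(4.39) for the gradient of the Newtonian potential**: there is an
absolute constant `C` such that for every `γ`-Hölder `f : ℝ³ → F` with constant `C_f`,
`0 < γ < 1`, bounded by `M_f` and supported in `B̄(c, R)`,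
`‖T_a f‖_∞ ≤ C‖a‖M_f(1 + R³)`, `‖D T_a f‖_∞ ≤ C‖a‖(C_f/γ + M_f R³)` and
`‖D T_a f(x) − D T_a f(x̄)‖ ≤ C‖a‖(C_f(γ⁻¹ + (1−γ)⁻¹ + 1) + M_f R³)|x − x̄|^γ`
(p. 129: "`|K₃f(0)| ≤ |K₃f|₀ ≤ c|f|₀` (4.38) … `‖∇K₃f‖_γ ≤ c‖f‖_γ` … `|K₃f|_{1,γ} ≤ c‖f‖_γ`
(4.39)", from Lemmas 4.5–4.6; here for the scalar building blocks `T_a`, the dependence on the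
support entering through `R³` as in Lemma 4.5's `m_f = R^N`). [cite: MajdaBertozziCUP2002, §4.1.3 (4.38)–(4.39) with Lemmas 4.5–4.6 (p. 129)] -/
theorem exists_newtonGradPotential_bounds :
    ∃ C : ℝ, 0 ≤ C ∧ ∀ (a : ℝ³) (f : ℝ³ → F) (Cf γ : ℝ≥0) (Mf R : ℝ) (c : ℝ³),
      HolderWith Cf γ f → 0 < γ → γ < 1 → (∀ y, ‖f y‖ ≤ Mf) → tsupport f ⊆ closedBall c R →
      0 ≤ R →
      (∀ x, ‖newtonGradPotential a f x‖ ≤ C * ‖a‖ * Mf * (1 + R ^ 3)) ∧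
      (∀ x, ‖fderiv ℝ (newtonGradPotential a f) x‖ ≤ C * ‖a‖ * (Cf / γ + Mf * R ^ 3)) ∧
      ∀ x x', ‖fderiv ℝ (newtonGradPotential a f) x - fderiv ℝ (newtonGradPotential a f) x'‖ ≤
        C * ‖a‖ * (Cf * (1 / γ + 1 / (1 - γ) + 1) + Mf * R ^ 3) * ‖x - x'‖ ^ (γ : ℝ) := by
  obtain ⟨C₁, hC₁0, hC₁⟩ := exists_abs_newtonNearGrad_le one_pos one_lt_two
  obtain ⟨Cn, hCn0, hCn⟩ := exists_newtonNearGradPotentialDeriv_bounds (F := F) one_pos one_lt_two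
  obtain ⟨N₁, N₂, N₃, hN₁0, hN₂0, hN₃0, hFar⟩ := exists_newtonFarGradPotential_bounds (F := F)
    one_pos one_lt_two
  set c₃ : ℝ := 3 * (volume : Measure ℝ³).real (ball 0 1) with hc₃
  have hc₃0 : 0 ≤ c₃ := three_mul_volume_real_ball_nonneg
  -- one constant dominating every piece
  set C : ℝ := 2 * C₁ * c₃ + 5 * N₁ + 2 * Cn + 5 * N₂ + 5 * (N₃ + 2 * N₂) + Cn with hC
  have hC0 : 0 ≤ C := by positivity
  have iC1 : 2 * C₁ * c₃ ≤ C := by rw [hC]; nlinarith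
  have iN1 : 5 * N₁ ≤ C := by rw [hC]; nlinarith [mul_nonneg hC₁0 hc₃0]
  have iCn2 : 2 * Cn ≤ C := by rw [hC]; nlinarith [mul_nonneg hC₁0 hc₃0]
  have iN2 : 5 * N₂ ≤ C := by rw [hC]; nlinarith [mul_nonneg hC₁0 hc₃0]
  have iN3 : 5 * (N₃ + 2 * N₂) ≤ C := by rw [hC]; nlinarith [mul_nonneg hC₁0 hc₃0]
  have iCn : Cn ≤ C := by rw [hC]; nlinarith [mul_nonneg hC₁0 hc₃0]
  refine ⟨C, hC0, fun a f Cf γ Mf R c hf hγ hγ1 hMf hsupp hR => ?_⟩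
  have hγ' : (0 : ℝ) < γ := by exact_mod_cast hγ
  have hγ1' : (γ : ℝ) < 1 := by exact_mod_cast hγ1
  have h1γ : 0 < 1 - (γ : ℝ) := by linarith
  have hfcont : Continuous f := hf.continuous hγ
  have hfc : HasCompactSupport f :=
    (isCompact_closedBall c R).of_isClosed_subset isClosed_closure hsupp
  have hMf0 : 0 ≤ Mf := (norm_nonneg _).trans (hMf c)
  have hI0 : 0 ≤ ∫ y, ‖f y‖ := integral_nonneg fun _ => norm_nonneg _
  have hI : ∫ y, ‖f y‖ ≤ 5 * Mf * R ^ 3 := integral_norm_le_of_tsupport_subset hMf hsupp hR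
  obtain ⟨hF0, hF1, hF2⟩ := hFar a f hfcont hfc
  obtain ⟨hn1, hn2⟩ := hCn a f Cf γ hf hγ hγ1
  have split := newtonGradPotential_eq_near_add_far' a hfcont hfc
  have ha : 0 ≤ ‖a‖ := norm_nonneg _
  refine ⟨fun x => ?_, fun x => ?_, fun x x' => ?_⟩
  · -- sup bound
    rw [newtonGradPotential_eq_near_add_far a hfcont hfc x]
    have b1 : ‖newtonNearGradPotential 1 2 a f x‖ ≤ C₁ * ‖a‖ * Mf * c₃ * 2 :=
      norm_newtonNearGradPotential_le one_pos one_lt_two hC₁0 hC₁ a hMf0 hMf x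
    have b2 : ‖newtonFarGradPotential 1 2 a f x‖ ≤ N₁ * ‖a‖ * (5 * Mf * R ^ 3) :=
      (hF0 x).trans (mul_le_mul_of_nonneg_left hI (by positivity))
    calc ‖newtonNearGradPotential 1 2 a f x + newtonFarGradPotential 1 2 a f x‖
        ≤ C₁ * ‖a‖ * Mf * c₃ * 2 + N₁ * ‖a‖ * (5 * Mf * R ^ 3) := norm_add_le_of_le b1 b2
      _ = (2 * C₁ * c₃) * (‖a‖ * Mf) + (5 * N₁) * (‖a‖ * Mf) * R ^ 3 := by ring
      _ ≤ C * (‖a‖ * Mf) + C * (‖a‖ * Mf) * R ^ 3 := by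
          have h0 : 0 ≤ ‖a‖ * Mf := by positivity
          exact add_le_add (mul_le_mul_of_nonneg_right iC1 h0)
            (mul_le_mul_of_nonneg_right (mul_le_mul_of_nonneg_right iN1 h0) (by positivity))
      _ = C * ‖a‖ * Mf * (1 + R ^ 3) := by ring
  · -- sup bound for the derivative
    rw [fderiv_newtonGradPotential a hf hγ hγ1 hfc x,
      fderiv_newtonNearGradPotential one_pos one_lt_two a hf hγ hγ1 x]
    have b1 : ‖newtonNearGradPotentialDeriv 1 2 a f x‖ ≤ Cn * ‖a‖ * Cf * (2 / γ) := by
      refine (hn1 x).trans (mul_le_mul_of_nonneg_left ?_ (by positivity))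
      refine div_le_div_of_nonneg_right ?_ hγ'.le
      calc (2 : ℝ) ^ (γ : ℝ) ≤ (2 : ℝ) ^ (1 : ℝ) :=
            Real.rpow_le_rpow_of_exponent_le (by norm_num) hγ1'.le
        _ = 2 := Real.rpow_one 2
    have b2 : ‖fderiv ℝ (newtonFarGradPotential 1 2 a f) x‖ ≤ N₂ * ‖a‖ * (5 * Mf * R ^ 3) :=
      (hF1 x).trans (mul_le_mul_of_nonneg_left hI (by positivity))
    calc ‖newtonNearGradPotentialDeriv 1 2 a f x + fderiv ℝ (newtonFarGradPotential 1 2 a f) x‖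
        ≤ Cn * ‖a‖ * Cf * (2 / γ) + N₂ * ‖a‖ * (5 * Mf * R ^ 3) := norm_add_le_of_le b1 b2
      _ = (2 * Cn) * (‖a‖ * (Cf / γ)) + (5 * N₂) * (‖a‖ * (Mf * R ^ 3)) := by ring
      _ ≤ C * (‖a‖ * (Cf / γ)) + C * (‖a‖ * (Mf * R ^ 3)) :=
          add_le_add (mul_le_mul_of_nonneg_right iCn2 (by positivity))
            (mul_le_mul_of_nonneg_right iN2 (by positivity))
      _ = C * ‖a‖ * (Cf / γ + Mf * R ^ 3) := by ring
  · -- Hölder bound for the derivative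
    rw [fderiv_newtonGradPotential a hf hγ hγ1 hfc x, fderiv_newtonGradPotential a hf hγ hγ1 hfc x',
      fderiv_newtonNearGradPotential one_pos one_lt_two a hf hγ hγ1 x,
      fderiv_newtonNearGradPotential one_pos one_lt_two a hf hγ hγ1 x']
    set t : ℝ := ‖x - x'‖ with ht
    have ht0 : 0 ≤ t := norm_nonneg _
    have b1 := hn2 x x'
    -- far: `min (N₃ t, 2 N₂) ∫‖f‖`
    have q1 : ‖fderiv ℝ (newtonFarGradPotential 1 2 a f) x -
        fderiv ℝ (newtonFarGradPotential 1 2 a f) x'‖ ≤ N₃ * t * (‖a‖ * ∫ y, ‖f y‖) := by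
      calc _ ≤ N₃ * ‖a‖ * ‖x - x'‖ * ∫ y, ‖f y‖ := hF2 x x'
        _ = N₃ * t * (‖a‖ * ∫ y, ‖f y‖) := by rw [ht]; ring
    have q2 : ‖fderiv ℝ (newtonFarGradPotential 1 2 a f) x -
        fderiv ℝ (newtonFarGradPotential 1 2 a f) x'‖ ≤ 2 * N₂ * (‖a‖ * ∫ y, ‖f y‖) := by
      calc _ ≤ ‖fderiv ℝ (newtonFarGradPotential 1 2 a f) x‖ +
            ‖fderiv ℝ (newtonFarGradPotential 1 2 a f) x'‖ := norm_sub_le _ _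
        _ ≤ N₂ * ‖a‖ * (∫ y, ‖f y‖) + N₂ * ‖a‖ * ∫ y, ‖f y‖ := add_le_add (hF1 x) (hF1 x')
        _ = 2 * N₂ * (‖a‖ * ∫ y, ‖f y‖) := by ring
    have hq : 0 ≤ ‖a‖ * ∫ y, ‖f y‖ := by positivity
    have b2 : ‖fderiv ℝ (newtonFarGradPotential 1 2 a f) x -
        fderiv ℝ (newtonFarGradPotential 1 2 a f) x'‖ ≤
        (N₃ + 2 * N₂) * t ^ (γ : ℝ) * (‖a‖ * (5 * Mf * R ^ 3)) := by
      by_cases hq0 : ‖a‖ * ∫ y, ‖f y‖ = 0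
      · have : ‖fderiv ℝ (newtonFarGradPotential 1 2 a f) x -
            fderiv ℝ (newtonFarGradPotential 1 2 a f) x'‖ ≤ 0 := by
          rw [hq0, mul_zero] at q2; exact q2
        exact this.trans (by positivity)
      · have hqpos : 0 < ‖a‖ * ∫ y, ‖f y‖ := lt_of_le_of_ne hq (Ne.symm hq0)
        have key := min_linear_const_le_rpow (N₂ := N₂) (N₃ := N₃) hN₂0 hN₃0 ht0 hγ' hγ1'.le
          (q := ‖fderiv ℝ (newtonFarGradPotential 1 2 a f) x -
            fderiv ℝ (newtonFarGradPotential 1 2 a f) x'‖ / (‖a‖ * ∫ y, ‖f y‖))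
          ((div_le_iff₀ hqpos).2 q1) ((div_le_iff₀ hqpos).2 q2)
        rw [div_le_iff₀ hqpos] at key
        refine key.trans (mul_le_mul_of_nonneg_left (mul_le_mul_of_nonneg_left hI ha) ?_)
        positivity
    calc ‖newtonNearGradPotentialDeriv 1 2 a f x + fderiv ℝ (newtonFarGradPotential 1 2 a f) x -
          (newtonNearGradPotentialDeriv 1 2 a f x' + fderiv ℝ (newtonFarGradPotential 1 2 a f) x')‖
        = ‖(newtonNearGradPotentialDeriv 1 2 a f x - newtonNearGradPotentialDeriv 1 2 a f x') +
            (fderiv ℝ (newtonFarGradPotential 1 2 a f) x -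
              fderiv ℝ (newtonFarGradPotential 1 2 a f) x')‖ := by congr 1; abel
      _ ≤ Cn * ‖a‖ * Cf * (1 / γ + 1 / (1 - γ) + 1) * t ^ (γ : ℝ) +
            (N₃ + 2 * N₂) * t ^ (γ : ℝ) * (‖a‖ * (5 * Mf * R ^ 3)) := norm_add_le_of_le b1 b2
      _ = Cn * (‖a‖ * (Cf * (1 / γ + 1 / (1 - γ) + 1)) * t ^ (γ : ℝ)) +
            (5 * (N₃ + 2 * N₂)) * (‖a‖ * (Mf * R ^ 3) * t ^ (γ : ℝ)) := by ring
      _ ≤ C * (‖a‖ * (Cf * (1 / γ + 1 / (1 - γ) + 1)) * t ^ (γ : ℝ)) +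
            C * (‖a‖ * (Mf * R ^ 3) * t ^ (γ : ℝ)) := by
          have hp1 : 0 ≤ ‖a‖ * (Cf * (1 / γ + 1 / (1 - γ) + 1)) * t ^ (γ : ℝ) := by positivity
          have hp2 : 0 ≤ ‖a‖ * (Mf * R ^ 3) * t ^ (γ : ℝ) := by positivity
          exact add_le_add (mul_le_mul_of_nonneg_right iCn hp1)
            (mul_le_mul_of_nonneg_right iN3 hp2)
      _ = C * ‖a‖ * (Cf * (1 / γ + 1 / (1 - γ) + 1) + Mf * R ^ 3) * t ^ (γ : ℝ) := by ring

end Deriv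

end Literature.Analysis.FluidPDE
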